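import Summits.CriticalPhenomena.PercolationContinuityZ3.Theorems.Transplant.ProdZ2Stacked
import HarnessLib

/-!
# `F □ ℤ²`, p205010-free routing VI: THE EXCEPTIONAL (STACKED) FAMILY, ADJACENT TERMINAL LEVELS (`g₁ ∼ g₂`) — the designs RIGHT / LEFT through a third
# neighbour of the edge, and the assembly **`FinProdZ2.stackedRouting`** (every connected `F` with a fork)

builds on p205010 (kernel theorem, internal audit signed; external expert review pending) — NOT used in this file.
Lane `prim-bschramm`, seat `prim-bschramm-p2` (gen 50; class C1b, METHOD = input substitution; memo `HOME/bschramm/P2-LATTICES.md` §161); helper file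
(`--supports stmt-CriticalPhenomena-4575 --as helper`).  Frame columns `a = A` (terminals `E₁ = (g₁,a)`, `E₂ = (g₂,a)`), `s = A + μ` (`w' = (g₃, s)`), `a' = A + ν`,
`s' = A + μ + ν`, `a'' = A + 2ν`, `s'' = A + μ + 2ν` («BccClawXStack».`Frame`; coefficients `(i, j)` of `A + i μ + j ν`).
* §1 `gpath_fpath'` (explicit end triples); **RIGHT** (`g₁ ∼ g₂ ∼ h`, `h ≠ g₁`): chain 1 = `E₁, (g₁,a'), (g₂,a'), (h,a'), (h,a), E₂` with the marked edge
  `(g₂,a') → (h,a')` and the branch `(g₂,s') → (g₂,s) ⇝ w'`; chain 2 = `E₁, (g₁,a'), (g₁,s'), (g₁,s''), (g₂,s''), (h,s''), (h,s'), (g₂,s'), (g₂,a'), E₂` with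
  the marked edge `(h,s') → (g₂,s')` and the branch `(h,a') → (h,a) → (h,s) ⇝ w'`.  **LEFT** (`h ∼ g₁ ∼ g₂`, `h ≠ g₂`): chain 1 = `E₁, (h,a), (h,a'), (g₁,a'),
  (g₂,a'), E₂`, edge `(h,a') → (g₁,a')`, branch `(h,s') → (h,s) ⇝ w'`; chain 2 = `E₁, (h,a), (h,a'), (h,s'), (h,s''), (g₁,s''), (g₂,s''), (g₂,s'), (g₂,a'), E₂`,
  edge `(h,a') → (h,s')`, branch `(g₁,a') → (g₁,s') → (g₁,s) ⇝ w'`;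
* §2 `FinProdZ2.StackedRouting` (the exceptional family of the exit-form certificate, as «BccSlabColRouting».`StackedRouting`) and **`stackedRouting`**: FAR
  («ProdZ2Stacked») when `g₁ ≁ g₂`, else a third vertex of the fork lies off `{g₁, g₂}`, a third neighbour of the edge exists («ProdZ2Paths».`exists_third_adj`),
  RIGHT or LEFT.
[cite: DuminilCopinSidoraviciusTassion2016, §2.3 (proof of Fact 2: the three disjoint self-avoiding paths in B̄_R(z))]
-/

noncomputable section

namespace Summit.CriticalPhenomena.PercolationContinuityZ3.Theorems.Transplant

namespace FinProdZ2

open Literature.Probability.Percolation Literature.Probability.LatticeModels SimpleGraph BccClawX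
open scoped Classical

variable {W : Type} {F : SimpleGraph W}

/-! ## §1 The designs RIGHT and LEFT -/

section Designs

variable {RP : Set (Site 2)} {A : Site 2} {μ ν : Pt} (Fr : Frame RP A μ ν) (hF : F.Connected) {WR Wc : Set (W × Site 2)}
  (hWR : ∀ x : W × Site 2, x.2 ∈ RP → x ∈ WR) (hW : ∀ x : W × Site 2, x.2 ∈ RP → x ∈ Wc)
include Fr

/-- «ProdZ2FrameKit».`gpath_fpath` with the end triples named. [folklore] -/
theorem gpath_fpath' {ts : List (W × ℤ × ℤ)} {t₀ t₁ : W × ℤ × ℤ} (hne : ts ≠ []) (h0 : ts.head hne = t₀) (h1 : ts.getLast hne = t₁) (hnd : ts.Nodup)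
    (hch : ts.IsChain (Step F)) : GPath (F □ zdGraph 2) (fpath A μ ν ts) (fv A μ ν t₀) (fv A μ ν t₁) := by
  rw [← h0, ← h1]; exact gpath_fpath Fr hne hnd hch

/-- Distinct coefficient pairs give distinct frame vertices. [folklore] -/
theorem fv_ne_of_snd_ne {t t' : W × ℤ × ℤ} (h : t.2 ≠ t'.2) : fv A μ ν t ≠ fv A μ ν t' := fun e => h (by rw [fv_inj Fr e])

include hF hWR hW

/-- **DESIGN RIGHT** (`g₁ ∼ g₂` and a third vertex `h ∼ g₂`). [cite: DuminilCopinSidoraviciusTassion2016, §2.3 (proof of Fact 2)] -/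
theorem swapPair_right {g₁ g₂ h g₃ : W} (h12 : F.Adj g₁ g₂) (h2h : F.Adj g₂ h) (hh1 : h ≠ g₁) :
    ∃ r₁ r₂ : VRouteData (F □ zdGraph 2) WR Wc (fv A μ ν (g₁, 0, 0)) (fv A μ ν (g₂, 0, 0)) (fv A μ ν (g₃, 1, 0)), r₁.y = r₂.b ∧ r₁.b = r₂.y := by
  have hg : g₁ ≠ g₂ := h12.ne
  have hh2 : h ≠ g₂ := h2h.ne.symm
  have hne : fv A μ ν (g₁, 0, 0) ≠ fv A μ ν (g₂, (0 : ℤ), (0 : ℤ)) := fun e => hg (by have := fv_inj Fr e; simpa using this)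
  have memF : ∀ {t : W × ℤ × ℤ} {ts : List (W × ℤ × ℤ)}, fv A μ ν t ∈ fpath A μ ν ts → t ∈ ts := fun ht => (fv_mem_fpath_iff Fr).1 ht
  have hallF : ∀ {ts : List (W × ℤ × ℤ)}, (∀ t ∈ ts, 0 ≤ t.2.1 ∧ t.2.1 ≤ 1 ∧ 0 ≤ t.2.2 ∧ t.2.2 ≤ 2) → ∀ v ∈ fpath A μ ν ts, v ∈ WR :=
    fun hts v hv => hWR v (snd_mem_of_mem_fpath Fr hts hv)
  -- ROUTING 1
  set ts₁ : List (W × ℤ × ℤ) := [(g₁, 0, 0), (g₁, 0, 1), (g₂, 0, 1), (h, 0, 1), (h, 0, 0), (g₂, 0, 0)] with hts₁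
  have hSP₁ : GPath (F □ zdGraph 2) (fpath A μ ν ts₁) (fv A μ ν (g₁, 0, 0)) (fv A μ ν (g₂, 0, 0)) :=
    gpath_fpath' Fr (by simp [hts₁]) rfl rfl (by simp [hts₁, hg, hh1.symm, hh2, hh2.symm])
      (List.isChain_cons_cons.2 ⟨Step.planar F g₁ (by norm_num), List.isChain_cons_cons.2 ⟨Step.fibre F h12 0 1, List.isChain_cons_cons.2
        ⟨Step.fibre F h2h 0 1, List.isChain_cons_cons.2 ⟨Step.planar F h (by norm_num), List.isChain_cons_cons.2
        ⟨Step.fibre F h2h.symm 0 0, List.IsChain.singleton _⟩⟩⟩⟩⟩)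
  obtain ⟨Br₁, hBr₁, hBr₁W, hBr₁mem⟩ := exists_tail Fr hF hW g₂ g₃ (i := 1) (j := 1) (Step.planar F g₂ (by norm_num)) (by norm_num) (by norm_num)
  obtain ⟨r₁, h1y, h1b⟩ := VRouteData.exists_ofPaths' (WR := WR) hSP₁ hne (hallF (by simp [hts₁]))
    ⟨fpath A μ ν [(g₁, 0, 0), (g₁, 0, 1)], fpath A μ ν [(h, 0, 0), (g₂, 0, 0)], rfl⟩ hBr₁ hBr₁W (fv_adj Fr (Step.planar F g₂ (by norm_num)))
    (by
      intro v hv hvS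
      rcases hBr₁mem v hv with rfl | ⟨f, rfl⟩
      · have := memF hvS; simp [hts₁] at this
      · have := memF hvS; simp [hts₁] at this)
  -- ROUTING 2
  set ts₂ : List (W × ℤ × ℤ) :=
    [(g₁, 0, 0), (g₁, 0, 1), (g₁, 1, 1), (g₁, 1, 2), (g₂, 1, 2), (h, 1, 2), (h, 1, 1), (g₂, 1, 1), (g₂, 0, 1), (g₂, 0, 0)] with hts₂
  have hSP₂ : GPath (F □ zdGraph 2) (fpath A μ ν ts₂) (fv A μ ν (g₁, 0, 0)) (fv A μ ν (g₂, 0, 0)) :=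
    gpath_fpath' Fr (by simp [hts₂]) rfl rfl (by simp [hts₂, hg, hh1.symm, hh2, hh2.symm])
      (List.isChain_cons_cons.2 ⟨Step.planar F g₁ (by norm_num), List.isChain_cons_cons.2 ⟨Step.planar F g₁ (by norm_num), List.isChain_cons_cons.2
        ⟨Step.planar F g₁ (by norm_num), List.isChain_cons_cons.2 ⟨Step.fibre F h12 1 2, List.isChain_cons_cons.2 ⟨Step.fibre F h2h 1 2,
        List.isChain_cons_cons.2 ⟨Step.planar F h (by norm_num), List.isChain_cons_cons.2 ⟨Step.fibre F h2h.symm 1 1, List.isChain_cons_cons.2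
        ⟨Step.planar F g₂ (by norm_num), List.isChain_cons_cons.2 ⟨Step.planar F g₂ (by norm_num), List.IsChain.singleton _⟩⟩⟩⟩⟩⟩⟩⟩⟩)
  obtain ⟨Br₂', hBr₂', hBr₂'W, hBr₂'mem⟩ := exists_tail Fr hF hW h g₃ (i := 0) (j := 0) (Step.planar F h (by norm_num)) (by norm_num) (by norm_num)
  have hBr₂ : GPath (F □ zdGraph 2) (fv A μ ν (h, 0, 1) :: Br₂') (fv A μ ν (h, 0, 1)) (fv A μ ν (g₃, 1, 0)) := by
    refine hBr₂'.cons (fv_adj Fr (Step.planar F h (by norm_num))) fun hv => ?_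
    rcases hBr₂'mem _ hv with e | ⟨f, e⟩
    · exact fv_ne_of_snd_ne Fr (by norm_num) e
    · exact fv_ne_of_snd_ne Fr (by norm_num) e
  obtain ⟨r₂, h2y, h2b⟩ := VRouteData.exists_ofPaths' (WR := WR) hSP₂ hne (hallF (by simp [hts₂]))
    ⟨fpath A μ ν [(g₁, 0, 0), (g₁, 0, 1), (g₁, 1, 1), (g₁, 1, 2), (g₂, 1, 2), (h, 1, 2)], fpath A μ ν [(g₂, 0, 1), (g₂, 0, 0)], rfl⟩ hBr₂
    (by
      intro v hv
      rcases List.mem_cons.1 hv with rfl | hv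
      · exact hW _ (snd_fv_mem Fr (by norm_num))
      · exact hBr₂'W v hv)
    (fv_adj Fr (Step.planar F h (by norm_num)))
    (by
      intro v hv hvS
      rcases List.mem_cons.1 hv with rfl | hv
      · have := memF hvS; simp [hts₂, hh1, hh2] at this
      rcases hBr₂'mem v hv with rfl | ⟨f, rfl⟩
      · have := memF hvS; simp [hts₂, hh1, hh2] at this
      · have := memF hvS; simp [hts₂] at this)
  exact ⟨r₁, r₂, by rw [h1y, h2b], by rw [h1b, h2y]⟩

/-- **DESIGN LEFT** (`g₁ ∼ g₂` and a third vertex `h ∼ g₁`). [cite: DuminilCopinSidoraviciusTassion2016, §2.3 (proof of Fact 2)] -/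
theorem swapPair_left {g₁ g₂ h g₃ : W} (h12 : F.Adj g₁ g₂) (h1h : F.Adj g₁ h) (hh2 : h ≠ g₂) :
    ∃ r₁ r₂ : VRouteData (F □ zdGraph 2) WR Wc (fv A μ ν (g₁, 0, 0)) (fv A μ ν (g₂, 0, 0)) (fv A μ ν (g₃, 1, 0)), r₁.y = r₂.b ∧ r₁.b = r₂.y := by
  have hg : g₁ ≠ g₂ := h12.ne
  have hh1 : h ≠ g₁ := h1h.ne.symm
  have hne : fv A μ ν (g₁, 0, 0) ≠ fv A μ ν (g₂, (0 : ℤ), (0 : ℤ)) := fun e => hg (by have := fv_inj Fr e; simpa using this)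
  have memF : ∀ {t : W × ℤ × ℤ} {ts : List (W × ℤ × ℤ)}, fv A μ ν t ∈ fpath A μ ν ts → t ∈ ts := fun ht => (fv_mem_fpath_iff Fr).1 ht
  have hallF : ∀ {ts : List (W × ℤ × ℤ)}, (∀ t ∈ ts, 0 ≤ t.2.1 ∧ t.2.1 ≤ 1 ∧ 0 ≤ t.2.2 ∧ t.2.2 ≤ 2) → ∀ v ∈ fpath A μ ν ts, v ∈ WR :=
    fun hts v hv => hWR v (snd_mem_of_mem_fpath Fr hts hv)
  -- ROUTING 1
  set ts₁ : List (W × ℤ × ℤ) := [(g₁, 0, 0), (h, 0, 0), (h, 0, 1), (g₁, 0, 1), (g₂, 0, 1), (g₂, 0, 0)] with hts₁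
  have hSP₁ : GPath (F □ zdGraph 2) (fpath A μ ν ts₁) (fv A μ ν (g₁, 0, 0)) (fv A μ ν (g₂, 0, 0)) :=
    gpath_fpath' Fr (by simp [hts₁]) rfl rfl (by simp [hts₁, hg, hh1, hh1.symm, hh2])
      (List.isChain_cons_cons.2 ⟨Step.fibre F h1h 0 0, List.isChain_cons_cons.2 ⟨Step.planar F h (by norm_num), List.isChain_cons_cons.2
        ⟨Step.fibre F h1h.symm 0 1, List.isChain_cons_cons.2 ⟨Step.fibre F h12 0 1, List.isChain_cons_cons.2
        ⟨Step.planar F g₂ (by norm_num), List.IsChain.singleton _⟩⟩⟩⟩⟩)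
  obtain ⟨Br₁, hBr₁, hBr₁W, hBr₁mem⟩ := exists_tail Fr hF hW h g₃ (i := 1) (j := 1) (Step.planar F h (by norm_num)) (by norm_num) (by norm_num)
  obtain ⟨r₁, h1y, h1b⟩ := VRouteData.exists_ofPaths' (WR := WR) hSP₁ hne (hallF (by simp [hts₁]))
    ⟨fpath A μ ν [(g₁, 0, 0), (h, 0, 0)], fpath A μ ν [(g₂, 0, 1), (g₂, 0, 0)], rfl⟩ hBr₁ hBr₁W (fv_adj Fr (Step.planar F h (by norm_num)))
    (by
      intro v hv hvS
      rcases hBr₁mem v hv with rfl | ⟨f, rfl⟩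
      · have := memF hvS; simp [hts₁] at this
      · have := memF hvS; simp [hts₁] at this)
  -- ROUTING 2
  set ts₂ : List (W × ℤ × ℤ) :=
    [(g₁, 0, 0), (h, 0, 0), (h, 0, 1), (h, 1, 1), (h, 1, 2), (g₁, 1, 2), (g₂, 1, 2), (g₂, 1, 1), (g₂, 0, 1), (g₂, 0, 0)] with hts₂
  have hSP₂ : GPath (F □ zdGraph 2) (fpath A μ ν ts₂) (fv A μ ν (g₁, 0, 0)) (fv A μ ν (g₂, 0, 0)) :=
    gpath_fpath' Fr (by simp [hts₂]) rfl rfl (by simp [hts₂, hg, hh1, hh1.symm, hh2])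
      (List.isChain_cons_cons.2 ⟨Step.fibre F h1h 0 0, List.isChain_cons_cons.2 ⟨Step.planar F h (by norm_num), List.isChain_cons_cons.2
        ⟨Step.planar F h (by norm_num), List.isChain_cons_cons.2 ⟨Step.planar F h (by norm_num), List.isChain_cons_cons.2 ⟨Step.fibre F h1h.symm 1 2,
        List.isChain_cons_cons.2 ⟨Step.fibre F h12 1 2, List.isChain_cons_cons.2 ⟨Step.planar F g₂ (by norm_num), List.isChain_cons_cons.2
        ⟨Step.planar F g₂ (by norm_num), List.isChain_cons_cons.2 ⟨Step.planar F g₂ (by norm_num), List.IsChain.singleton _⟩⟩⟩⟩⟩⟩⟩⟩⟩)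
  obtain ⟨Br₂', hBr₂', hBr₂'W, hBr₂'mem⟩ := exists_tail Fr hF hW g₁ g₃ (i := 1) (j := 1) (Step.planar F g₁ (by norm_num)) (by norm_num) (by norm_num)
  have hBr₂ : GPath (F □ zdGraph 2) (fv A μ ν (g₁, 0, 1) :: Br₂') (fv A μ ν (g₁, 0, 1)) (fv A μ ν (g₃, 1, 0)) := by
    refine hBr₂'.cons (fv_adj Fr (Step.planar F g₁ (by norm_num))) fun hv => ?_
    rcases hBr₂'mem _ hv with e | ⟨f, e⟩
    · exact fv_ne_of_snd_ne Fr (by norm_num) e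
    · exact fv_ne_of_snd_ne Fr (by norm_num) e
  obtain ⟨r₂, h2y, h2b⟩ := VRouteData.exists_ofPaths' (WR := WR) hSP₂ hne (hallF (by simp [hts₂]))
    ⟨fpath A μ ν [(g₁, 0, 0), (h, 0, 0)], fpath A μ ν [(h, 1, 2), (g₁, 1, 2), (g₂, 1, 2), (g₂, 1, 1), (g₂, 0, 1), (g₂, 0, 0)], rfl⟩ hBr₂
    (by
      intro v hv
      rcases List.mem_cons.1 hv with rfl | hv
      · exact hW _ (snd_fv_mem Fr (by norm_num))
      · exact hBr₂'W v hv)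
    (fv_adj Fr (Step.fibre F h1h.symm 0 1))
    (by
      intro v hv hvS
      rcases List.mem_cons.1 hv with rfl | hv
      · have := memF hvS; simp [hts₂, hg, hh1.symm] at this
      rcases hBr₂'mem v hv with rfl | ⟨f, rfl⟩
      · have := memF hvS; simp [hts₂, hg, hh1.symm] at this
      · have := memF hvS; simp [hts₂] at this)
  exact ⟨r₁, r₂, by rw [h1y, h2b], by rw [h1b, h2y]⟩

end Designs

/-! ## §2 Stacked routing for every connected `F` with a fork -/

/-- **STACKED ROUTING** (internal obligation, the exceptional family of the exit-form certificate for `F □ ℤ²`): for every block pair and every frame `(A; μ, ν)`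
in the rerouting region, all `E₁ ≠ E₂` over `A` and `w'` over `A + μ`, a swap pair of `VRouteData` for the cleared sets.  (Product twin of
«BccSlabColRouting».`StackedRouting`; discharged below.) [cite: DuminilCopinSidoraviciusTassion2016, §2.3 (proof of Fact 2: the three disjoint paths in B̄_R(z))] -/
def StackedRouting [Fintype W] (F : SimpleGraph W) : Prop :=
  ∀ (z : Site 2) (tR tD sR sD : ℕ) (E₁ E₂ w' : W × Site 2) (μ ν : Pt), E₁ ≠ E₂ → sh E₁ = sh E₂ →
    Frame (BccSlab.Dcols z tD sD ∩ sqBlkR 3 z tR sR) (sh E₁) μ ν → sh w' = fcol (sh E₁) μ ν 1 0 →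
      ∃ r₁ r₂ : VRouteData (F □ zdGraph 2) (clearedSet z tD sD ∩ (sqShadow F).lift (sqBlkR 3 z tR sR)) (clearedSet z tD sD) E₁ E₂ w',
        r₁.y = r₂.b ∧ r₁.b = r₂.y

/-- Three pairwise distinct vertices do not fit into `{g₁, g₂}`. [folklore] -/
theorem exists_ne_ne {c₀ a₀ b₀ : W} (φ : Fork F c₀ a₀ b₀) (g₁ g₂ : W) : ∃ t : W, t ≠ g₁ ∧ t ≠ g₂ := by
  by_contra hcon
  push Not at hcon
  rcases eq_or_ne c₀ g₁ with hc1 | hc1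
  · have ha1 : a₀ ≠ g₁ := fun e => φ.ne₁ (hc1.trans e.symm)
    have hb1 : b₀ ≠ g₁ := fun e => φ.ne₂ (hc1.trans e.symm)
    exact φ.hab ((hcon a₀ ha1).trans (hcon b₀ hb1).symm)
  · have hc2 := hcon c₀ hc1
    rcases eq_or_ne a₀ g₁ with ha1 | ha1
    · have hb1 : b₀ ≠ g₁ := fun e => φ.hab (ha1.trans e.symm)
      exact φ.ne₂ (hc2.trans (hcon b₀ hb1).symm)
    · exact φ.ne₁ (hc2.trans (hcon a₀ ha1).symm)

/-- **STACKED ROUTING HOLDS for every connected `F` with a fork** (a vertex with two distinct neighbours): FAR when the two terminal levels are not adjacent in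
`F`, else RIGHT or LEFT through a third neighbour of the edge `g₁ ∼ g₂` (it exists: some vertex of the fork is off `{g₁, g₂}` and `F` is connected).
[cite: DuminilCopinSidoraviciusTassion2016, §2.3 (proof of Fact 2: the three disjoint paths in B̄_R(z))] -/
theorem stackedRouting [Fintype W] (hF : F.Connected) {c₀ a₀ b₀ : W} (φ : Fork F c₀ a₀ b₀) : StackedRouting F := by
  intro z tR tD sR sD E₁ E₂ w' μ ν hne h12 Fr hs
  obtain ⟨g₁, x₁⟩ := E₁
  obtain ⟨g₂, x₂⟩ := E₂
  obtain ⟨g₃, x₃⟩ := w'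
  simp only [sh_mk] at h12 Fr hs
  subst h12
  subst hs
  have hWR : ∀ x : W × Site 2, x.2 ∈ BccSlab.Dcols z tD sD ∩ sqBlkR 3 z tR sR →
      x ∈ clearedSet (W := W) z tD sD ∩ (sqShadow F).lift (sqBlkR 3 z tR sR) := fun x hx => ⟨hx.1, hx.2⟩
  have hW : ∀ x : W × Site 2, x.2 ∈ BccSlab.Dcols z tD sD ∩ sqBlkR 3 z tR sR → x ∈ clearedSet (W := W) z tD sD := fun x hx => hx.1
  have hg : g₁ ≠ g₂ := fun e => hne (by rw [e])
  have e1 : ((g₁, x₁) : W × Site 2) = fv x₁ μ ν (g₁, 0, 0) := Prod.ext rfl (fcol_zero x₁ μ ν).symm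
  have e2 : ((g₂, x₁) : W × Site 2) = fv x₁ μ ν (g₂, 0, 0) := Prod.ext rfl (fcol_zero x₁ μ ν).symm
  have e3 : ((g₃, fcol x₁ μ ν 1 0) : W × Site 2) = fv x₁ μ ν (g₃, 1, 0) := rfl
  rw [e1, e2, e3]
  by_cases hadj : F.Adj g₁ g₂
  · obtain ⟨t, ht1, ht2⟩ := exists_ne_ne φ g₁ g₂
    obtain ⟨h, hh1, hh2, h1h | h2h⟩ := exists_third_adj F hF ht1 ht2
    · exact swapPair_left Fr hF hWR hW hadj h1h hh2
    · exact swapPair_right Fr hF hWR hW hadj h2h hh1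
  · exact swapPair_far Fr hF hWR hW hg hadj

end FinProdZ2

end Summit.CriticalPhenomena.PercolationContinuityZ3.Theorems.Transplant

end
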